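import Mathlib
import HarnessLib
import HarnessLib.Audit
import Summits.ValiantsHypothesis.Statement
import Literature.Computability.AlgebraicComplexity.DeterminantalComplexity
import Literature.Computability.AlgebraicComplexity.StandardFamilies

/-!
Route: BirkhoffNewtonClass

CLOSED (retired) 2026-08-15T13:51:33Z by operator:999:1257524 — reason: not-a-thesis: assembly does not conclude the sub-problem Statement — note: D-0027 §2.1 audit (human 2026-08-15: routes that do not decide the summit are removed): the assembly concludes `SuperQuadraticDc`, not the sub-problem statement; a NEW conforming route may be opened from the same idea (generated `closes : … → _root_.ValiantsHypothesis`).. The file is kept as the record of this route; refuted decls are indexed as negative knowledge (`ledger negatives`).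

# Route BirkhoffNewtonClass — per is a rigid member of the Birkhoff Newton family and the generic
member has full class, so dc(per_n) is super-quadratic

Realises card birkhoff-faces-bkk-class (Bernstein–Kouchnirenko on the Birkhoff polytope as the
engine for the Class Conjecture C of the
companion card class-conjecture-superquadratic-dc), in CORRECTED form. Put the permanent in its
Newton family
f_c = Σ_σ c_σ Π_i x_{σ(i) i} (support = the n! vertices of the Birkhoff polytope B_n; per_n = f_1,
det_n = f_sign) and let
class(V(f)) = number of hyperplanes of a general pencil tangent to V(f) at smooth points (degree of
the dual hypersurface; 0 for det_n).
It suffices to show X = G ∧ R ∧ P0: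
(G) GenericBirkhoffClass — for some α > 0 the GENERIC member has class κ_n ≥ n^{α n²} (a statement
of toric geometry: by
Ernström/Matsui–Takeuchi and Khovanskii, κ_n is an explicit signed sum of mixed volumes of the
polytopes conv{σ ⊆ S}, S ⊆ [n]²);
(R) PermanentNewtonRigidity — class(P_n) ≥ ε^{n²} κ_n: the all-ones member loses at most an
exponential factor, while the sign member
(det) loses everything;
(P0) DeterminantalConormalBound — class(P_n) ≤ B(m, n²) = Σ_i C(m,i) C(m−1,n²−1−i) C(n²−2,i−1)
whenever per_n = det of an m×m
affine-linear matrix (arXiv:2606.13628 Thm 3, specialised).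
Then class(P_n) ≥ (ε n^{α})^{n²} and dc(per_n) ≥ (ε/(4e) − o(1)) n^{2+α} ≥ n^{2+α/2}: the TARGET is
DetQP's crux DetqpSuperquadratic (same signature, shared item); α = 1
(Conjecture C) gives dc(per_n) ≥ c n³. HONEST SCOPE: a waypoint, not Summit.ValiantsHypothesis —
class ≤ n(n−1)^{n²−2} caps the
method at m ~ n³. "Generic" is encoded as "outside the zero set of one nonzero polynomial Φ in the
data (c, pencils, charts)"; class as
the Set.ncard of the affine tangency set {x | f x = 0, ∇f x ≠ 0, ∇f x ∈ span(a,b), l x = 1}; no new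
definitions are needed.
Lean: `(∃ α : ℝ, 0 < α ∧ ∃ n₀ : ℕ, ∀ n ≥ n₀, ∃ Φ : MvPolynomial (Equiv.Perm (Fin n) ⊕ (Fin 6 × (Fin
n × Fin n))) ℂ, Φ ≠ 0 ∧ ∀ u : (Equiv.Perm (Fin n) ⊕ (Fin 6 × (Fin n × Fin n))) → ℂ,
MvPolynomial.eval u Φ ≠ 0 → (n : ℝ) ^ (α * n * n) ≤ (Set.ncard {x : Fin n × Fin n → ℂ |
MvPolynomial.eval x (∑ σ : Equiv.Perm (Fin n), MvPolynomial.C (u (Sum.inl σ)) * ∏ i : Fin n,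
MvPolynomial.X (σ i, i)) = 0 ∧ (∃ p, MvPolynomial.eval x (MvPolynomial.pderiv p (∑ σ : Equiv.Perm
(Fin n), MvPolynomial.C (u (Sum.inl σ)) * ∏ i : Fin n, MvPolynomial.X (σ i, i))) ≠ 0) ∧ (∃ s t : ℂ,
∀ p, MvPolynomial.eval x (MvPolynomial.pderiv p (∑ σ : Equiv.Perm (Fin n), MvPolynomial.C (u
(Sum.inl σ)) * ∏ i : Fin n, MvPolynomial.X (σ i, i))) = s * u (Sum.inr (0, p)) + t * u (Sum.inr (1,
p))) ∧ ∑ p, u (Sum.inr (2, p)) * x p = 1} : ℝ)) ∧ (∃ ε : ℝ, 0 < ε ∧ ∃ n₀ : ℕ, ∀ n ≥ n₀, ∃ Φ :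
MvPolynomial (Equiv.Perm (Fin n) ⊕ (Fin 6 × (Fin n × Fin n))) ℂ, Φ ≠ 0 ∧ ∀ u : (Equiv.Perm (Fin n) ⊕
(Fin 6 × (Fin n × Fin n))) → ℂ, MvPolynomial.eval u Φ ≠ 0 → ε ^ (n * n) * (Set.ncard {x : Fin n ×
Fin n → ℂ | MvPolynomial.eval x (∑ σ : Equiv.Perm (Fin n), MvPolynomial.C (u (Sum.inl σ)) * ∏ i :
Fin n, MvPolynomial.X (σ i, i)) = 0 ∧ (∃ p, MvPolynomial.eval x (MvPolynomial.pderiv p (∑ σ :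
Equiv.Perm (Fin n), MvPolynomial.C (u (Sum.inl σ)) * ∏ i : Fin n, MvPolynomial.X (σ i, i))) ≠ 0) ∧
(∃ s t : ℂ, ∀ p, MvPolynomial.eval x (MvPolynomial.pderiv p (∑ σ : Equiv.Perm (Fin n),
MvPolynomial.C (u (Sum.inl σ)) * ∏ i : Fin n, MvPolynomial.X (σ i, i))) = s * u (Sum.inr (0, p)) + t
* u (Sum.inr (1, p))) ∧ ∑ p, u (Sum.inr (2, p)) * x p = 1} : ℝ) ≤ (Set.ncard {x : Fin n × Fin n → ℂ
| MvPolynomial.eval x (Literature.Computability.AlgebraicComplexity.perPoly (Fin n) ℂ) = 0 ∧ (∃ p,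
MvPolynomial.eval x (MvPolynomial.pderiv p (Literature.Computability.AlgebraicComplexity.perPoly
(Fin n) ℂ)) ≠ 0) ∧ (∃ s t : ℂ, ∀ p, MvPolynomial.eval x (MvPolynomial.pderiv p
(Literature.Computability.AlgebraicComplexity.perPoly (Fin n) ℂ)) = s * u (Sum.inr (3, p)) + t * u
(Sum.inr (4, p))) ∧ ∑ p, u (Sum.inr (5, p)) * x p = 1} : ℝ)) ∧ (∀ n ≥ 3, ∀ m : ℕ,
Literature.Computability.AlgebraicComplexity.HasDetRepr
(Literature.Computability.AlgebraicComplexity.perPoly (Fin n) ℂ) m → ∃ Φ : MvPolynomial (Equiv.Perm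
(Fin n) ⊕ (Fin 6 × (Fin n × Fin n))) ℂ, Φ ≠ 0 ∧ ∀ u : (Equiv.Perm (Fin n) ⊕ (Fin 6 × (Fin n × Fin
n))) → ℂ, MvPolynomial.eval u Φ ≠ 0 → Set.ncard {x : Fin n × Fin n → ℂ | MvPolynomial.eval x
(Literature.Computability.AlgebraicComplexity.perPoly (Fin n) ℂ) = 0 ∧ (∃ p, MvPolynomial.eval x
(MvPolynomial.pderiv p (Literature.Computability.AlgebraicComplexity.perPoly (Fin n) ℂ)) ≠ 0) ∧ (∃ s
t : ℂ, ∀ p, MvPolynomial.eval x (MvPolynomial.pderiv p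
(Literature.Computability.AlgebraicComplexity.perPoly (Fin n) ℂ)) = s * u (Sum.inr (3, p)) + t * u
(Sum.inr (4, p))) ∧ ∑ p, u (Sum.inr (5, p)) * x p = 1} ≤ ∑ i ∈ Finset.Icc 1 (n * n - 1), Nat.choose
m i * Nat.choose (m - 1) (n * n - 1 - i) * Nat.choose (n * n - 2) (i - 1))`

## Assembly
Elementary algebra + arithmetic, no geometry: fix n ≥ max(n₀(G), n₀(R), 3); take m = dc(per_n),
which carries a representation
(`Literature.Computability.AlgebraicComplexity.hasDetRepr_determinantalComplexity_holds`); the three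
genericity polynomials live in the
SAME ring MvPolynomial (Perm(Fin n) ⊕ Fin 6 × (Fin n × Fin n)) ℂ, their product is nonzero (domain)
and has a non-root u
(`MvPolynomial.funext`, ℂ infinite); at u: n^{αn²} ≤ #T(f_c), ε^{n²} #T(f_c) ≤ #T(per), #T(per) ≤
B(m,n²) ≤ 2^{n²−2} C(2m−1, n²−1)
(Vandermonde `Nat.add_choose_eq`) ≤ 2^{n²−2} (2em/(n²−1))^{n²−1} (`Real.pow_div_factorial_le_exp`),
whence
m ≥ (n²−1)(ε n^{α})^{1+o(1)}/(4e) ≥ n^{2+α/2} for n large.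

Rationale: WHY THIS LINE. The enumerative escape from the #variables wall: every rank/flattening invariant of
per_n is ≤ poly(n²), but the class of the permanental
hypersurface can be n^{Θ(n²)}, and the 2026 two-kernel conormal Bézout (arXiv:2606.13628 Thm 3, no
smoothness hypothesis;
arXiv:2606.11090 Rem 5) converts class(P_n) ≥ n^{αn²} into dc(per_n) ≳ n^{2+α}/(4e) — ANY positive
exponent already breaks the
Mignon–Ressayre ceiling (MignonRessayre2004; B(m,n²) = 0 for 2m < n² re-derives n²/2 from class ≥
1). The card's BKK engine is kept but
repaired: the tangency system is Bernstein-degenerate for EVERY polynomial supported on B_n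
(row/column-weight directions: V(f) contains
the coordinate spaces {row i = 0} and is singular in codimension 2n for all coefficients), so
MV(B_n, Q_n^{N−2}, Δ) is nobody's class and
the right benchmark is the generic member κ_n of the Newton family, below which per can only drop
(conormal specialisation). This splits
Conjecture C into a permanent-free toric statement G (tools: Bernstein doi:10.1007/bf01075595,
Khovanskii doi:10.1007/bf01077562,
Ernström doi:10.1080/00927879708826029, Matsui–Takeuchi doi:10.1090/s0002-9939-08-09270-8,
Breiding–Sottile–Woodcock arXiv:2012.06350
for BKK-exactness of Lagrange-type systems, Brualdi–Gibson doi:10.1016/0097-3165(77)90051-6 for the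
face lattice of B_n) and a
per-specific rigidity statement R whose enemy is visible: per's extra singular components are
exactly the block faces
{X_off = 0, per X₁₁ = per X₂₂ = 0} (2 ≤ k ≤ n−2, codim 2k(n−k)+2), where per_{G₁⊔G₂} =
per_{G₁}·per_{G₂} factors and a generic member
does not; det shares them AND collapses through torus singularities (rank ≤ n−2, codim 4), per
conjecturally has none
(PermanentTorusSmooth; Landsberg2017 §6.3.3, arXiv:2402.17839). Imported area: toric/convex geometry
(mixed volumes, polyhedral
homotopy doi:10.2307/2153370) and projective duality; no prior route of this summit (DetQP, GCTMult,
Elusive, Depth4, TauConst,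
BoolTransfer, IntegralGCT) uses an enumerative invariant; negatives index empty.

RANKED CRUXES. #0 SuperQuadraticDc (target) — ∃ ε > 0 with dc(per_n) ≥ n^{2+ε} for all large n —
verbatim the signature of DetQP.DetqpSuperquadratic (stmt-ValiantsHypothesis-0318), so the item is
shared; X gives it with 2+ε = 2+α/2 (and n³ at α = 1). (why it might fail: it is DetQP's hardest
crux: every engine so far saturates at Θ(n²) (MR04 Hessian rank, LMR13 dual nondegeneracy, ABV17
singular-locus codimension); X reaches it only if κ_n and class(P_n) are genuinely n^{Θ(n²)}.)
[MignonRessayre2004, arXiv:1004.4802, AlperBogartVelasco2017, Landsberg2017]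
#2 PermanentNewtonRigidity (crux) — (R) ∃ ε > 0 ∃ n₀ ∀ n ≥ n₀: for generic data u = (c, a, b, l, a′,
b′, l′) (outside {Φ = 0}, Φ ≠ 0), ε^{n²} · #(tangency set of the generic Newton-family member f_c
w.r.t. pencil (a,b), chart l) ≤ #(tangency set of per_n w.r.t. (a′,b′), chart l′); i.e. class(P_n) ≥
ε^{n²} κ_n. Card item "decomposable faces cost little", made honest. [difficulty: XL] (why it might
fail: per's symmetry adds singular components absent generically (block type {X_off=0, per X11 = per
X22 = 0}, codim 2k(n-k)+2) and maybe torus singularities; their Plücker corrections could cost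
n^{Θ(n²)} rather than exp(O(n²)); only class(P_n) ≥ 1 (MR04) is known.) [MignonRessayre2004,
Landsberg2017, arXiv:2402.17839, doi:10.2307/2153370, doi:10.1007/bf01075595]
#3 GenericBirkhoffClass (crux) — (G) ∃ α > 0 ∃ n₀ ∀ n ≥ n₀: for generic data u (outside {Φ = 0}),
the tangency set of f_c = Σ_σ c_σ Π_i X_{σ i, i} w.r.t. pencil (a,b) and chart l has ≥ n^{α n²}
points; i.e. the generic hypersurface with Newton polytope = Birkhoff polytope has class κ_n ≥ n^{α
n²} (card item F3, re-aimed at the right number). [difficulty: L] (why it might fail: V(f_c)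
contains the codim-n spaces {row i = 0} and is singular in codim 2n for EVERY member; the
Ernström–Khovanskii signed mixed-volume sum may cancel down to κ_n = n^{o(n²)} (weights like
C(n²,2n)(n-1)^{n²-2n} rival n(n-1)^{n²-2}); only μ_k = n(n-1)^k for k ≤ 2n-2 is safe.)
[doi:10.1080/00927879708826029, doi:10.1090/s0002-9939-08-09270-8, doi:10.1007/bf01077562,
arXiv:2012.06350, doi:10.1016/0097-3165(77)90051-6]
#4 DeterminantalConormalBound (crux) — (P0) for n ≥ 3 and every m, if per_n has an m×m affine
determinantal representation then for generic pencil/chart the tangency set of per_n has ≤ B(m,n²) =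
Σ_{i=1}^{n²−1} C(m,i)·C(m−1,n²−1−i)·C(n²−2,i−1) points (class(P_n) ≤ two-kernel Bézout number;
arXiv:2606.13628 Thm 3 with F = x₀^{m−n} per_n, cone shift, pdeg of an effective cycle ≥ pdeg of the
summand conormal(P_n)). Assembly-gating external claim. [difficulty: L] (why it might fail: rests on
arXiv:2606.13628 Thm 3, an unrefereed LLM-assisted 2026 preprint: its claim that genuine polar
points are isolated reduced points of the two-kernel incidence for ANY affine A (singular,
non-reduced V(F)) may hide an excess-component gap.) [arXiv:2606.13628, arXiv:2606.11090,
Fulton1998, MignonRessayre2004]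
#5 PermanentTorusSmooth (crux) — for n ≥ 3 no complex n×n matrix with all entries nonzero has all
its (n−1)×(n−1) subpermanents equal to zero, i.e. Sing(P_n) misses the torus (the facial condition
in the torus-singularity direction, where det_n collapses: Sing(D_n) = rank ≤ n−2 meets the torus in
codim 4). Known for n = 3 (Landsberg Lemma 6.3.3.4). Mechanism crux for R (no excess component of
the tangency system inside the torus); not in the assembly. [difficulty: M] (why it might fail: open
beyond n = 3 (Landsberg Q 6.3.3.7; BCMV 2025 prove only codim Sing ≥ 6 and conjecture a bipartition
structure, Conj 4.27); one structured full-support matrix (circulant / roots-of-unity type) with all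
maximal subpermanents 0 at some n ≥ 4 refutes it.) [Landsberg2017, arXiv:2402.17839,
Vonzurgathen1987]
#9 DeterminantClassZero (support) — calibration of the encoding on the sign member: for n ≥ 3 and
generic pencil/chart the tangency set of det_n is EMPTY (∇det = adjugateᵀ has rank 1 at smooth
points and a generic 2-plane of n×n matrices contains no rank-1 matrix; n = 2 is excluded: V(det₂)
is a smooth quadric). A refuter's junk-guard: the same count that must be huge for per is provably 0
for det. [difficulty: provable-now] [Landsberg2017]

TWO-LAYER PLAN. Foreseen glued splits (none filed now). G ⇐ G1 → G2 → G with G1 (Ernström–Khovanskii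
bookkeeping): κ_n = (−1)^{n²}[χ(V) − 2χ(V∩H) +
χ(V∩H∩H′)] written as an explicit signed sum over supports S ⊆ [n]² of mixed volumes of conv{σ ⊆ S}
and simplices — provable
bookkeeping once `mixedVolume` exists; G2: that sum is ≥ n^{αn²} (the convex-geometric heart). R ⇐
R1 → R2 → R3 → R with R1: along the
coefficient homotopy c → 1 (Huber–Sturmfels), tangency paths of f_c are lost only in Bernstein
directions where per's facial system has
torus zeros and the generic one has not, and these are the block directions 2 ≤ k ≤ n−2 plus the
torus-singularity direction (the
card's Conjecture F, corrected: for CONNECTED elementary G the pattern permanent per_G is smooth on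
its torus); R2: the block directions
swallow at most a (1 − ε^{n²}) fraction (product structure per_{G₁⊔G₂} = per_{G₁} per_{G₂}, blocks
of codim ≥ 4n−6); R3 =
PermanentTorusSmooth. P0 ⇐ (named Literature fact for arXiv:2606.13628 Thm 3, cite request filed) →
specialisation to F = x₀^{m−n}·per_n.

KILL CRITERIA. κ_n ≤ n^{o(n²)} (an exact toric evaluation, or κ_4 collapsing far below 4·3^{14})
refutes G and closes the route `refuted:GenericBirkhoffClass`
— and kills Conjecture C for the companion card too, since class(P_n) ≤ κ_n. class(P_n) ≤ n^{o(n²)}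
with κ_n large refutes R: close
`refuted:PermanentNewtonRigidity` (the permanent is then "det-like" for duality — a new identity
worth recording as negative knowledge).
A gap in arXiv:2606.13628 Thm 3 refutes only the form of P0: pivot by `--restate` to the
smooth-point version using codim Sing(P_n) ≥ 6
(arXiv:2402.17839). PermanentTorusSmooth refuted ⇒ `--drop` it (not in the assembly; R must then
absorb an excess component).
DetQP.DetqpSuperquadratic proved by any other route moots this one (close superseded).

NOT DECOMPOSED YET. The mixed-volume bookkeeping G1 and the lower bound G2 (need `mixedVolume`/BKK
definitions); the path-accounting R1–R2 (need Bernstein's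
theorem B and polyhedral homotopy in Lean — far from Mathlib); the exact Plücker corrections of the
block components; the pattern-permanent
generalisation of PermanentTorusSmooth (connected elementary G); the α = 1 (n³) sharpening; anything
about border complexity (polar degrees
are not closed under degeneration, arXiv:2606.13628 §1).

CHEAPEST FALSIFIER. n = 3, where the Newton family modulo torus rescaling is ONE parameter θ = c_e
c_(123) c_(132) / (c_(12) c_(13) c_(23)) (per: θ = 1,
det: θ = −1): solve the 9-variable tangency system (≤ 384 = 3·2⁷ solutions) for random θ, for θ = 1
and near θ = −1 with msolve /
HomotopyContinuation — R and G predict #T(1) within a constant factor of #T(θ_generic) > 0 and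
#T(−1) = 0 (DeterminantClassZero). Then
n = 4 (κ_4 and class(P_4) against 4·3^{14} = 19 131 876) decides whether the exponent survives the
codim-8 singular strata. For
PermanentTorusSmooth: one Gröbner basis of the 16 cubic subpermanents of a 4×4 matrix saturated by Π
x_ij. Not run this session (no CAS on
the hub; to be filed as one kit job shared with cards class-conjecture-superquadratic-dc and
polar-degree-baur-strassen).

NUMBERS. Smooth value n(n−1)^{n²−2}: 384 (n = 3), 4·3^{14} (n = 4). Known: 1 ≤ class(P_n) ≤ κ_n ≤
n(n−1)^{n²−2}; polar degrees
μ_k(P_n) = n(n−1)^k for k ≤ 2n−2 (generic sections of codim > dim Sing are smooth). B(m,N) = 0 for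
2m < N; B(N/2,N) ≈ 2^N/√N;
class ≥ n^{αn²} ⟹ dc(per_n) ≥ (1/(4e) − o(1)) n^{2+α}; class ≤ n^{n²} ⟹ method ceiling m ≲ n³.
dc(per_n): n²/2 ≤ dc ≤ 2ⁿ − 1, dc(per_3) = 7.
codim Sing(P_n): ≤ 2n, = 6 for n = 3 (components off the torus), ∈ {8, 10} in ℂ^{16} for n = 4
(vzG87), ≥ 6 for n ≥ 6 (arXiv:2402.17839).
Block components: codim 2k(n−k)+2 ≥ 4n−6 (k ≥ 2). Items at open: 7 (1 target, 4 cruxes, 1 support, 1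
assembly).

DEFINITION REQUESTS. (1) `hypersurfaceClass f` (Literature/AlgebraicGeometry): degree of the dual
variety of V(f) ⊂ ℙ^{N−1} = generic pencil tangency count —
inlined three times above as a Set.ncard; (2) `mixedVolume` and the Bernstein–Kouchnirenko count
(Literature/Geometry) for the layer-2 items
G1, R1; (3) cite/fact request: arXiv:2606.13628 Thm 3 (determinantal conormal bound, any affine A)
as a named Literature fact, so that P0
can later be re-filed as `(h : Fact) →` bookkeeping.

Novelty: Searches (2026-08-15): `lit search --hybrid` ×3 (local: Landsberg2017 pp.168–172, LMR13
galaxy-pdf-8572435590081880720, Cox–Little–O'Shea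
§7.5 — no class/dual-degree computation for per); `lit search --source zbmath` ×9 ("permanent
hypersurface dual variety" 0,
"permanental hypersurface" 1 = arXiv:2402.17839, "polar degrees Newton polytope" 0, "dual variety
degree Newton polyhedron" 0, plus the
classics below); `lit frontier ValiantsHypothesis --since 2020` (30 rows: arXiv:2606.11090,
arXiv:2606.13628 the only polar-degree
items); `lit read` of arXiv:2606.11090, arXiv:2606.13628 (Thm 3), arXiv:2402.17839 (Conj 4.27),
Landsberg2017 §6.3–6.4; openalex/s2/arxiv
remote rate-limited (HTTP 429) and `lit galaxy search --star all` timed out (queue > 90 s) this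
session — recorded, not worked around.
Nearest prior art found: arXiv:2606.13628 Thm 3 / arXiv:2606.11090 (conormal Bézout ⟹ dc from polar
degree, applied only to SMOOTH
Fermat-type hypersurfaces); arXiv:1004.4802 + MignonRessayre2004 (dual of P_n is a hypersurface —
degree never studied);
arXiv:2012.06350 (BKK-exactness of Lagrange systems of generic sparse polynomials — the template for
computing κ_n);
doi:10.1090/s0002-9939-08-09270-8 and doi:10.1080/00927879708826029 (class via Euler characteristics
of generic sections);
doi:10.1016/0097-3165(77)90051-6 (faces of B_n); arXiv:2402.17839 (Sing(P_n)). Cards: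
class-conjecture-superquadratic-dc (the reduction
C ⟹ n³, claims wrongly that sub-full exponents give nothing), polar-de  [refs: 10.1090/s0002-9939-08-09270-8, 10.1080/00927879708826029, 10.1016/0097-3165(77, 2402.17839, 2606.11090, 2606.13628, 1004.4802, 2012.06350, doi:10.1090/s0002-9939-08-09270-8, doi:10.1080/00927879708826029, doi:10.1016/0097-3165, Landsberg2017, MignonRessayre2004]

Barriers (technique_class: polar-degree, bkk-toric, newton-family-rigidity): - technique_class: polar-degree, bkk-toric, newton-family-rigidity
- Literature.Barriers.ValiantsHypothesis.PartialDerivativesDetPerm: evaded by construction — all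
full-support members of the Newton family have the SAME flattening ranks (the barrier file's
finrank_span_derivSet_permSum) while their class runs from 0 (det) to κ_n; class is not a function
of flattening ranks.
- Literature.Barriers.ValiantsHypothesis.ShiftedPartialsCannotSeparate: not engaged (an intersection
number, multiplicative, not a rank of a linear image of the form); conceded that the route's own
ceiling m ~ n³ lies far below the ELSW range n > 2m²+2m anyway.
- Literature.Barriers.ValiantsHypothesis.RankMethods: formally about tensor/Waring rank
certification; class is a degree, not a sub-additive rank, so the EGOW sub-multiplicativity ceiling
does not apply; honest bet: enumerative invariants of size n^{Θ(n²)} are the one known way past the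
#variables wall.
- Literature.Barriers.ValiantsHypothesis.RankLifting: same answer as RankMethods (lifted ranks are
still ranks); not used.
- Literature.Barriers.ValiantsHypothesis.PermanentCharTwo: consistent — every statement is over ℂ
and uses the coefficients (per = f_1 vs det = f_sign); in characteristic 2 the family point per =
det has class 0 and arXiv:2606.13628 notes the bound fails in positive characteristic; the route
proves nothing characteristic-free.
- Literature.Barriers.ValiantsHypothesis.AlgebraicNaturalProofs: not engaged at this waypoint
(target is

History (route lifecycle, newest last):
- 2026-08-15T13:51:33Z · CLOSED retired — not-a-thesis: assembly does not conclude the sub-problem Statement (operator:999:1257524)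

sub-problem: ValiantsHypothesis · status: closed(retired) · opened planner-plancard-ValiantsHypothesis-ValiantsH-1db4652b-0 2026-08-15T11:35:38Z · rev 0 · ledger route-ValiantsHypothesis-BirkhoffNewtonClass
GENERATED by the gate from the ledger (D-0016/17). Provers cite these decls: `theorem foo : Summit.ValiantsHypothesis.ValiantsHypothesis.Theses.BirkhoffNewtonClass.<Decl> := …` in Summits/ValiantsHypothesis/ValiantsHypothesis/Theorems/<Name>.lean.
-/

namespace Summit.ValiantsHypothesis.ValiantsHypothesis.Theses.BirkhoffNewtonClass

open scoped BigOperators Topology Manifold Classical MeasureTheory ProbabilityTheory Matrix InnerProductSpace ComplexConjugate ContinuousMap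
open Filter Set Function TopologicalSpace MeasureTheory

attribute [summit_statement] _root_.ValiantsHypothesis

open Literature.PNP

/-- item stmt-ValiantsHypothesis-0318 · target · rank 0 · open · by planner
why it might fail: it is DetQP's hardest crux: every engine so far saturates at Θ(n²) (MR04 Hessian rank, LMR13 dual nondegeneracy, ABV17 singular-locus codimension); X reaches it only if κ_n and class(P_n) are genuinely n^{Θ(n²)}.
sources: MignonRessayre2004, arXiv:1004.4802, AlperBogartVelasco2017, Landsberg2017
Break the Hessian-rank ceiling: known dc(per_n) ≥ n^2/2 [MignonRessayre2004 Thm 1.1; CaiChenLi2010],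
dc(per_3)=7 [AlperBogartVelasco2017]; upper bound 2^n-1 [Grenet2011]. Any ε>0 requires a new
invariant of the determinant hypersurface (higher fundamental forms / singular-locus flattenings).
Most informative crux of the route. -/
@[route_item "route-ValiantsHypothesis-BirkhoffNewtonClass"]
def SuperQuadraticDc : Prop :=
  ∃ ε : ℝ, 0 < ε ∧ ∃ n₀ : ℕ, ∀ n ≥ n₀, (n : ℝ) ^ (2 + ε) ≤ (Literature.Computability.AlgebraicComplexity.determinantalComplexity (Literature.Computability.AlgebraicComplexity.perPoly (Fin n) ℂ) : ℝ)

/-- item stmt-ValiantsHypothesis-4913 · crux · rank 2 · closed · moot by None · by planner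
why it might fail: per's symmetry adds singular components absent generically (block type {X_off=0, per X11 = per X22 = 0}, codim 2k(n-k)+2) and maybe torus singularities; their Plücker corrections could cost n^{Θ(n²)} rather than exp(O(n²)); only class(P_n) ≥ 1 (MR04) is known.
sources: MignonRessayre2004, Landsberg2017, arXiv:2402.17839, doi:10.2307/2153370, doi:10.1007/bf01075595
[crux] (R) ∃ ε > 0 ∃ n₀ ∀ n ≥ n₀: for generic data u = (c, a, b, l, a′, b′, l′) (outside {Φ = 0}, Φ
≠ 0), ε^{n²} · #(tangency set of the generic Newton-family member f_c w.r.t. pencil (a,b), chart l)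
≤ #(tangency set of per_n w.r.t. (a′,b′), chart l′); i.e. class(P_n) ≥ ε^{n²} κ_n. Card item
"decomposable faces cost little", made honest. [difficulty: XL] -/
@[route_item "route-ValiantsHypothesis-BirkhoffNewtonClass"]
def PermanentNewtonRigidity : Prop :=
  ∃ ε : ℝ, 0 < ε ∧ ∃ n₀ : ℕ, ∀ n ≥ n₀, ∃ Φ : MvPolynomial (Equiv.Perm (Fin n) ⊕ (Fin 6 × (Fin n × Fin n))) ℂ, Φ ≠ 0 ∧ ∀ u : (Equiv.Perm (Fin n) ⊕ (Fin 6 × (Fin n × Fin n))) → ℂ, MvPolynomial.eval u Φ ≠ 0 → ε ^ (n * n) * (Set.ncard {x : Fin n × Fin n → ℂ | MvPolynomial.eval x (∑ σ : Equiv.Perm (Fin n), MvPolynomial.C (u (Sum.inl σ)) * ∏ i : Fin n, MvPolynomial.X (σ i, i)) = 0 ∧ (∃ p, MvPolynomial.eval x (MvPolynomial.pderiv p (∑ σ : Equiv.Perm (Fin n), MvPolynomial.C (u (Sum.inl σ)) * ∏ i : Fin n, MvPolynomial.X (σ i, i))) ≠ 0) ∧ (∃ s t : ℂ, ∀ p,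 MvPolynomial.eval x (MvPolynomial.pderiv p (∑ σ : Equiv.Perm (Fin n), MvPolynomial.C (u (Sum.inl σ)) * ∏ i : Fin n, MvPolynomial.X (σ i, i))) = s * u (Sum.inr (0, p)) + t * u (Sum.inr (1, p))) ∧ ∑ p, u (Sum.inr (2, p)) * x p = 1} : ℝ) ≤ (Set.ncard {x : Fin n × Fin n → ℂ | MvPolynomial.eval x (Literature.Computability.AlgebraicComplexity.perPoly (Fin n) ℂ) = 0 ∧ (∃ p, MvPolynomial.eval x (MvPolynomial.pderiv p (Literature.Computability.AlgebraicComplexity.perPoly (Fin n) ℂ)) ≠ 0) ∧ (∃ s t : ℂ, ∀ p, MvPolynomial.eval x (MvPolynomial.pderiv p (Literature.Computability.AlgebraicComplexity.perPoly (Fin n) ℂ)) = s * u (Sum.inr (3, p)) + t * u (Sum.inr (4, p))) ∧ ∑ p, u (Sum.inr (5, p)) * x p = 1} : ℝ)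

/-- item stmt-ValiantsHypothesis-4914 · crux · rank 3 · closed · moot by None · by planner
why it might fail: V(f_c) contains the codim-n spaces {row i = 0} and is singular in codim 2n for EVERY member; the Ernström–Khovanskii signed mixed-volume sum may cancel down to κ_n = n^{o(n²)} (weights like C(n²,2n)(n-1)^{n²-2n} rival n(n-1)^{n²-2}); only μ_k = n(n-1)^k for k ≤ 2n-2 is safe.
sources: doi:10.1080/00927879708826029, doi:10.1090/s0002-9939-08-09270-8, doi:10.1007/bf01077562, arXiv:2012.06350, doi:10.1016/0097-3165(77)90051-6
[crux] (G) ∃ α > 0 ∃ n₀ ∀ n ≥ n₀: for generic data u (outside {Φ = 0}), the tangency set of f_c =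
Σ_σ c_σ Π_i X_{σ i, i} w.r.t. pencil (a,b) and chart l has ≥ n^{α n²} points; i.e. the generic
hypersurface with Newton polytope = Birkhoff polytope has class κ_n ≥ n^{α n²} (card item F3,
re-aimed at the right number). [difficulty: L] -/
@[route_item "route-ValiantsHypothesis-BirkhoffNewtonClass"]
def GenericBirkhoffClass : Prop :=
  ∃ α : ℝ, 0 < α ∧ ∃ n₀ : ℕ, ∀ n ≥ n₀, ∃ Φ : MvPolynomial (Equiv.Perm (Fin n) ⊕ (Fin 6 × (Fin n × Fin n))) ℂ, Φ ≠ 0 ∧ ∀ u : (Equiv.Perm (Fin n) ⊕ (Fin 6 × (Fin n × Fin n))) → ℂ, MvPolynomial.eval u Φ ≠ 0 → (n : ℝ) ^ (α * n * n) ≤ (Set.ncard {x : Fin n × Fin n → ℂ | MvPolynomial.eval x (∑ σ : Equiv.Perm (Fin n), MvPolynomial.C (u (Sum.inl σ)) * ∏ i : Fin n, MvPolynomial.X (σ i, i)) = 0 ∧ (∃ p, MvPolynomial.eval x (MvPolynomial.pderiv p (∑ σ : Equiv.Perm (Fin n), MvPolynomial.C (u (Sum.inl σ)) * ∏ i : Fin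 n, MvPolynomial.X (σ i, i))) ≠ 0) ∧ (∃ s t : ℂ, ∀ p, MvPolynomial.eval x (MvPolynomial.pderiv p (∑ σ : Equiv.Perm (Fin n), MvPolynomial.C (u (Sum.inl σ)) * ∏ i : Fin n, MvPolynomial.X (σ i, i))) = s * u (Sum.inr (0, p)) + t * u (Sum.inr (1, p))) ∧ ∑ p, u (Sum.inr (2, p)) * x p = 1} : ℝ)

/-- item stmt-ValiantsHypothesis-4915 · crux · rank 4 · closed · moot by None · by planner
why it might fail: rests on arXiv:2606.13628 Thm 3, an unrefereed LLM-assisted 2026 preprint: its claim that genuine polar points are isolated reduced points of the two-kernel incidence for ANY affine A (singular, non-reduced V(F)) may hide an excess-component gap.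
sources: arXiv:2606.13628, arXiv:2606.11090, Fulton1998, MignonRessayre2004
[crux] (P0) for n ≥ 3 and every m, if per_n has an m×m affine determinantal representation then for
generic pencil/chart the tangency set of per_n has ≤ B(m,n²) = Σ_{i=1}^{n²−1}
C(m,i)·C(m−1,n²−1−i)·C(n²−2,i−1) points (class(P_n) ≤ two-kernel Bézout number; arXiv:2606.13628 Thm
3 with F = x₀^{m−n} per_n, cone shift, pdeg of an effective cycle ≥ pdeg of the summand
conormal(P_n)). Assembly-gating external claim. [difficulty: L] -/
@[route_item "route-ValiantsHypothesis-BirkhoffNewtonClass"]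
def DeterminantalConormalBound : Prop :=
  ∀ n ≥ 3, ∀ m : ℕ, Literature.Computability.AlgebraicComplexity.HasDetRepr (Literature.Computability.AlgebraicComplexity.perPoly (Fin n) ℂ) m → ∃ Φ : MvPolynomial (Equiv.Perm (Fin n) ⊕ (Fin 6 × (Fin n × Fin n))) ℂ, Φ ≠ 0 ∧ ∀ u : (Equiv.Perm (Fin n) ⊕ (Fin 6 × (Fin n × Fin n))) → ℂ, MvPolynomial.eval u Φ ≠ 0 → Set.ncard {x : Fin n × Fin n → ℂ | MvPolynomial.eval x (Literature.Computability.AlgebraicComplexity.perPoly (Fin n) ℂ) = 0 ∧ (∃ p, MvPolynomial.eval x (MvPolynomial.pderiv p (Literature.Computability.AlgebraicComplexity.perPoly (Fin n) ℂ)) ≠ 0) ∧ (∃ s t : ℂ, ∀ p, MvPolynomial.eval x (MvPolynomial.pderiv p (Literature.Computability.AlgebraicComplexity.perPoly (Fin n) ℂ)) = s * u (Sum.inr (3, p)) + t * u (Sum.inr (4, p))) ∧ ∑ p, u (Sum.inr (5, p)) * x p = 1} ≤ ∑ i ∈ Finset.Icc 1 (n * n - 1), Nat.choose m i * Nat.choose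 (m - 1) (n * n - 1 - i) * Nat.choose (n * n - 2) (i - 1)

/-- item stmt-ValiantsHypothesis-4916 · crux · rank 5 · closed · moot by None · by planner
why it might fail: open beyond n = 3 (Landsberg Q 6.3.3.7; BCMV 2025 prove only codim Sing ≥ 6 and conjecture a bipartition structure, Conj 4.27); one structured full-support matrix (circulant / roots-of-unity type) with all maximal subpermanents 0 at some n ≥ 4 refutes it.
sources: Landsberg2017, arXiv:2402.17839, Vonzurgathen1987
[crux] for n ≥ 3 no complex n×n matrix with all entries nonzero has all its (n−1)×(n−1)
subpermanents equal to zero, i.e. Sing(P_n) misses the torus (the facial condition in the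
torus-singularity direction, where det_n collapses: Sing(D_n) = rank ≤ n−2 meets the torus in codim
4). Known for n = 3 (Landsberg Lemma 6.3.3.4). Mechanism crux for R (no excess component of the
tangency system inside the torus); not in the assembly. [difficulty: M] -/
@[route_item "route-ValiantsHypothesis-BirkhoffNewtonClass"]
def PermanentTorusSmooth : Prop :=
  ∀ m : ℕ, 2 ≤ m → ∀ A : Matrix (Fin (m + 1)) (Fin (m + 1)) ℂ, (∀ i j, A i j ≠ 0) → ∃ i j : Fin (m + 1), (A.submatrix i.succAbove j.succAbove).permanent ≠ 0

/-- item stmt-ValiantsHypothesis-4917 · support · rank 9 · closed · moot by None · by planner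
sources: Landsberg2017
[support] calibration of the encoding on the sign member: for n ≥ 3 and generic pencil/chart the
tangency set of det_n is EMPTY (∇det = adjugateᵀ has rank 1 at smooth points and a generic 2-plane
of n×n matrices contains no rank-1 matrix; n = 2 is excluded: V(det₂) is a smooth quadric). A
refuter's junk-guard: the same count that must be huge for per is provably 0 for det. [difficulty:
provable-now] -/
@[route_item "route-ValiantsHypothesis-BirkhoffNewtonClass"]
def DeterminantClassZero : Prop :=
  ∀ n ≥ 3, ∃ Φ : MvPolynomial (Equiv.Perm (Fin n) ⊕ (Fin 6 × (Fin n × Fin n))) ℂ, Φ ≠ 0 ∧ ∀ u : (Equiv.Perm (Fin n) ⊕ (Fin 6 × (Fin n × Fin n))) → ℂ, MvPolynomial.eval u Φ ≠ 0 → {x : Fin n × Fin n → ℂ | MvPolynomial.eval x (Literature.Computability.AlgebraicComplexity.detPoly (Fin n) ℂ) = 0 ∧ (∃ p, MvPolynomial.eval x (MvPolynomial.pderiv p (Literature.Computability.AlgebraicComplexity.detPoly (Fin n) ℂ)) ≠ 0) ∧ (∃ s t : ℂ, ∀ p, MvPolynomial.eval x (MvPolynomial.pderiv p (Literature.Computability.AlgebraicComplexity.detPoly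 (Fin n) ℂ)) = s * u (Sum.inr (3, p)) + t * u (Sum.inr (4, p))) ∧ ∑ p, u (Sum.inr (5, p)) * x p = 1} = ∅

/-- item stmt-ValiantsHypothesis-4918 · assembly · rank 1 · closed · moot by None · by planner
sources: arXiv:2606.13628, MignonRessayre2004
[assembly] GenericBirkhoffClass → PermanentNewtonRigidity → DeterminantalConormalBound →
SuperQuadraticDc. -/
@[route_item "route-ValiantsHypothesis-BirkhoffNewtonClass"]
def Assembly : Prop :=
  GenericBirkhoffClass → PermanentNewtonRigidity → DeterminantalConormalBound → SuperQuadraticDc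

end Summit.ValiantsHypothesis.ValiantsHypothesis.Theses.BirkhoffNewtonClass
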